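import Mathlib
import Summits.ResolutionOfSingularities.ResolutionOfSingularities.Theorems.HomologicalConductorPersistenceDerivationHomotopy
import Literature.RingTheory.CohomologyAnnihilator.NoetherDifferentAnnihilator
import Literature.RingTheory.CohomologyAnnihilator.SyzygyBasic
import Literature.RingTheory.CohomologyAnnihilator.RegularRing
import HarnessLib

/-!
# Hypersurface Jacobian criterion: `(n zⁿ⁻¹, δF) ⊆ caᵈ⁺¹(S[z]/(zⁿ + F))` over a base of global dimension `d`

Crux `HomologicalConductor.Persistence` (stmt-ResolutionOfSingularities-16484), chain W4.4b.
`[OURS · L1 w44b]` — our own packaging of the derivation homotopy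
(`Theorems/HomologicalConductorPersistenceDerivationHomotopy.lean`, p484085) and of the noether
different ([IyengarTakahashi2014, Prop. 3.4], `Literature/…/NoetherDifferentAnnihilator.lean`) into
MEMBERSHIPS in the cohomology annihilator: the Jacobian lower bound `J(f)·B ⊆ caᵈ⁺¹(B)` for a
hypersurface `zⁿ + F = 0` over a base `S` of global dimension `≤ d`, which the chain's hand
computations use at every hypersurface stage (KILL-CANDIDATE-A2xLine Step 1 "`(x,t,z²) ⊆ ca⁴(T₀)`
by the Jacobian / MF homotopy", P3, D1). NOT a statement of the manuscript under review;
AI-drafted (weaker than expert review).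

Setting: `S` noetherian with `caᵈ⁺¹(S) = S` (every finitely generated `S`-module has projective
dimension `≤ d`; e.g. `S` regular of dimension `≤ d`, `cohomologyAnnihilatorOfDegree_eq_top_of_isRegularRing`,
or `S = k[x₁, …, x_d]`, `cohomologyAnnihilatorOfDegree_mvPolynomial_eq_top`), and `B = S[z]` a
commutative `S`-algebra generated by one element `z` (`Algebra.adjoin S {z} = ⊤`) with `zⁿ + F = 0`
(`F ∈ S`), finitely generated and projective as an `S`-MODULE (e.g. `B = S[X]/(Xⁿ + F)`, `n ≠ 0`,
free of rank `n`: `adjoinRoot_free_finite`).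

* `algebraMap_derivation_mem_cohomologyAnnihilatorOfDegree` — **`δF ∈ caᵈ⁺¹(B)`** for every
  derivation `δ` of `S` (exponent one, characteristic-free). Proof: a `d`-th syzygy `K = Ωᵈ_B M`
  restricts to a `d`-th syzygy over `S` (finitely generated projective `B`-modules are finitely
  generated projective over `S`: `projective_restrictScalars`, `isSyzygy_restrictScalars`), hence is
  `S`-PROJECTIVE as `pd_S M|_S ≤ d` (`projective_restrictScalars_of_isSyzygy`); so `δF` stably
  annihilates `K` (`PersistenceDerivationHomotopy.smul_ext_eq_zero_of_derivation`: `δF • 1_K`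
  factors through the `B`-projective `B ⊗_S K`), killing `Ext^{≥1}_B(K, -)`, and dimension shifting
  along the syzygy chain gives `Ext^{≥ d+1}_B(M, -)`.
* `natCast_mul_pow_mem_noetherDifferent` — **`n zⁿ⁻¹ ∈ 𝔑(B/S)`** (Euler element
  `Σ zⁱ ⊗ zⁿ⁻¹⁻ⁱ`, telescoping), hence `natCast_mul_pow_mem_cohomologyAnnihilatorOfDegree` —
  **`n zⁿ⁻¹ ∈ caᵈ⁺¹(B)`** by Prop. 3.4 with `I' = S` (`extAnnihilatorFrom_restrictScalars_eq_top`: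
  `B|_S` is projective).
* `span_jacobian_le_cohomologyAnnihilatorOfDegree` — the ideal `(n zⁿ⁻¹, δᵢ F : i)·B ⊆ caᵈ⁺¹(B)`;
* `noetherDifferent_le_cohomologyAnnihilatorOfDegree` — `𝔑(B/S) ⊆ caᵈ⁺¹(B)` for ANY module-finite
  projective `B` over `S` (no monogenicity; Prop. 3.4 with `I' = S`);
  `adjoinRoot_algebraMap_derivation_mem`, `adjoinRoot_natCast_mul_root_pow_mem` (`B = S[X]/(Xⁿ + F)`);
  `mvPolynomial_span_jacobian_le` — over `S = k[x₁, …, x_d]` (any field `k`, any characteristic):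
  `(n zⁿ⁻¹, ∂F/∂x₁, …, ∂F/∂x_d)·B ⊆ caᵈ⁺¹(B)` for `B = k[x][z]/(zⁿ + F)`. Instance (char `k ≠ 3`):
  `A₂ × line = k[x,t,u][z]/(z³ - xt)` gives `(3z², -t, -x, 0)`, i.e. `(x, t, z²) ⊆ ca⁴`.

Deliberately NOT here: localisation at a point (compose with
`map_cohomologyAnnihilatorOfDegree_le_of_isLocalization`); general (non-pure) monic relations
`f(z) = 0` (the same telescoping with `f`-coefficients — `TODO(general form)`); the unit/characteristic
bookkeeping turning `(3z², -t, -x)` into `(x, t, z²)`.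
-/

-- single-problem summit: the doubled namespace component is forced
set_option linter.dupNamespace false

noncomputable section

open CategoryTheory CategoryTheory.Abelian CategoryTheory.Limits
open scoped TensorProduct

universe u

namespace Summit.ResolutionOfSingularities.ResolutionOfSingularities.Theorems.HomologicalConductor.PersistenceHypersurfaceJacobian

open Literature.RingTheory.CohomologyAnnihilator
open Summit.ResolutionOfSingularities.ResolutionOfSingularities.Theorems.HomologicalConductor.PersistenceDerivationHomotopy

/-! ## Restriction of scalars of syzygies along a module-finite projective algebra -/

section Restrict

variable {A : Type u} [CommRing A] {B : Type u} [CommRing B] [Algebra A B]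

/-- A finitely generated projective `B`-module restricts to a projective object of `ModuleCat A`
when `B` is projective over `A` (it is a retract of some `Bʳ`, over `B` and hence over `A`; and
`Bʳ ≅ Π₀ B` is `A`-projective). [folklore] -/
theorem projective_restrictScalars [Module.Projective A B] (P : ModuleCat.{u} B)
    [Module.Finite B P] [Module.Projective B P] :
    Projective ((restrictScalarsFunctor A B).obj P) := by
  classical
  obtain ⟨n, f, hf⟩ := Module.Finite.exists_fin' B P
  obtain ⟨g, hg⟩ := Module.projective_lifting_property f LinearMap.id hf
  letI : Module A P := Module.compHom P (algebraMap A B)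
  haveI : IsScalarTower A B P := IsScalarTower.of_algebraMap_smul fun _ _ => rfl
  haveI : Module.Projective A (Fin n → B) :=
    Module.Projective.of_equiv (DFinsupp.linearEquivFunOnFintype (R := A) (M := fun _ : Fin n => B))
  have hP : Module.Projective A P :=
    Module.Projective.of_split (g.restrictScalars A) (f.restrictScalars A)
      (LinearMap.ext fun x => LinearMap.congr_fun hg x)
  exact (IsProjective.iff_projective (R := A) ((restrictScalarsFunctor A B).obj P)).mp hP

/-- **Syzygies restrict.** If `B` is module-finite and projective over `A`, a `s`-th syzygy
`K = Ωˢ_B M` over `B` restricts to a `s`-th syzygy `K|_A` of `M|_A` over `A` (each defining sequence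
stays exact, its middle term stays finitely generated projective). [folklore] -/
theorem isSyzygy_restrictScalars [Module.Finite A B] [Module.Projective A B] :
    ∀ (s : ℕ) {M K : ModuleCat.{u} B}, IsSyzygy s M K →
      IsSyzygy s ((restrictScalarsFunctor A B).obj M) ((restrictScalarsFunctor A B).obj K)
  | 0, _, _, ⟨e⟩ => ⟨(restrictScalarsFunctor A B).mapIso e⟩
  | s + 1, M, K, ⟨K', P, hK', hPfin, hP, f, g, w, hS⟩ => by
    haveI := hPfin
    haveI : Module.Projective B P := moduleProjective_of_projective P hP
    refine ⟨(restrictScalarsFunctor A B).obj K', (restrictScalarsFunctor A B).obj P,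
      isSyzygy_restrictScalars s hK', finite_restrictScalars P, projective_restrictScalars P,
      (restrictScalarsFunctor A B).map f, (restrictScalarsFunctor A B).map g, ?_, ?_⟩
    · rw [← Functor.map_comp, w, Functor.map_zero]
    · exact hS.map_of_exact (restrictScalarsFunctor A B)

/-- **`d`-th syzygies over `B` are projective over a base of global dimension `≤ d`.** Let `B` be
module-finite and projective over the noetherian ring `A` with `caᵈ⁺¹(A) = A`. Then for every
finitely generated `B`-module `M` and every `d`-th syzygy `K = Ωᵈ_B M`, the restriction `K|_A` is a
projective object of `ModuleCat A` (`pd_A M|_A ≤ d` and dimension shifting along the restricted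
syzygy chain). [folklore] -/
theorem projective_restrictScalars_of_isSyzygy [IsNoetherianRing A] [Module.Finite A B]
    [Module.Projective A B] {d : ℕ} (hvan : cohomologyAnnihilatorOfDegree A (d + 1) = ⊤)
    {M K : ModuleCat.{u} B} [Module.Finite B M] (hK : IsSyzygy d M K) :
    Projective ((restrictScalarsFunctor A B).obj K) := by
  set R := restrictScalarsFunctor A B
  -- dimension shifting for projective dimension along a syzygy chain (over any ring)
  have shift : ∀ (s : ℕ) {M' K' : ModuleCat.{u} A}, IsSyzygy s M' K' → ∀ n : ℕ,
      HasProjectiveDimensionLT M' (n + 1 + s) → HasProjectiveDimensionLT K' (n + 1) := by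
    intro s
    induction s with
    | zero =>
      intro M' K' hK' n h
      obtain ⟨e⟩ := hK'
      haveI := h
      exact hasProjectiveDimensionLT_of_iso e.symm (n + 1)
    | succ s ih =>
      intro M' K' hK' n h
      obtain ⟨K'', P, hK'', _, hP, f, g, w, hS⟩ := hK'
      have h' : HasProjectiveDimensionLT K'' (n + 1 + 1) :=
        ih hK'' (n + 1) (by rwa [show n + 1 + 1 + s = n + 1 + (s + 1) by omega])
      haveI : Projective P := hP
      have hP' : HasProjectiveDimensionLT (ShortComplex.mk f g w).X₂ (n + 1) :=
        hasProjectiveDimensionLT_of_ge P 1 (n + 1) (by omega)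
      exact hS.hasProjectiveDimensionLT_X₁ (n + 1) hP' h'
  haveI : Module.Finite A (R.obj M) := finite_restrictScalars M
  have hM : HasProjectiveDimensionLT (R.obj M) (0 + 1 + d) := by
    rw [Nat.zero_add, Nat.add_comm]
    exact hasProjectiveDimensionLT_of_cohomologyAnnihilatorOfDegree_eq_top hvan (R.obj M)
  have hK1 : HasProjectiveDimensionLT (R.obj K) (0 + 1) :=
    shift d (isSyzygy_restrictScalars d hK) 0 hM
  exact projective_iff_hasProjectiveDimensionLT_one.mpr (by simpa using hK1)

end Restrict

/-! ## The derivation half of the Jacobian criterion -/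

section Jacobian

variable {S : Type u} [CommRing S] {B : Type u} [CommRing B] [Algebra S B]

/-- **`δF ∈ caᵈ⁺¹(S[z]/(zⁿ + F))`.** Let `S` be noetherian with `caᵈ⁺¹(S) = S`, `B = S[z]`
(`Algebra.adjoin S {z} = ⊤`) with `zⁿ + F = 0`, `B` finitely generated and projective as an
`S`-module, and `δ` a derivation of `S`. Then `δ F ∈ caᵈ⁺¹(B)`: `d`-th syzygies over `B` are
`S`-projective (`projective_restrictScalars_of_isSyzygy`), `δF` stably annihilates them
(`PersistenceDerivationHomotopy.smul_ext_eq_zero_of_derivation`) and dimension shifting concludes —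
exponent ONE, no hypothesis on the characteristic. [folklore] -/
theorem algebraMap_derivation_mem_cohomologyAnnihilatorOfDegree [IsNoetherianRing S]
    [Module.Finite S B] [Module.Projective S B] {d : ℕ}
    (hvan : cohomologyAnnihilatorOfDegree S (d + 1) = ⊤) {R : Type*} [CommRing R] [Algebra R S]
    (δ : Derivation R S S) {z : B} (hz : Algebra.adjoin S {z} = ⊤) {n : ℕ} {F : S}
    (hzF : z ^ n + algebraMap S B F = 0) :
    algebraMap S B (δ F) ∈ cohomologyAnnihilatorOfDegree B (d + 1) := by
  haveI : IsNoetherianRing B := isNoetherian_of_tower S inferInstance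
  rw [mem_cohomologyAnnihilatorOfDegree_iff_of_isNoetherianRing]
  intro M N hM hN e
  haveI := hM
  obtain ⟨K, _, hK⟩ := exists_isSyzygy M d
  -- `K|_S` is `S`-projective
  have hKproj : Projective ((restrictScalarsFunctor S B).obj K) :=
    projective_restrictScalars_of_isSyzygy hvan hK
  letI : Module S K := Module.compHom K (algebraMap S B)
  haveI : IsScalarTower S B K := IsScalarTower.of_algebraMap_smul fun _ _ => rfl
  haveI : Module.Projective S K :=
    (IsProjective.iff_projective (R := S) ((restrictScalarsFunctor S B).obj K)).mpr hKproj
  have h1 : ∀ N' : ModuleCat.{u} B, Module.Finite B N' →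
      ∀ e' : Ext.{u} K N' 1, algebraMap S B (δ F) • e' = 0 := fun N' _ e' =>
    smul_ext_eq_zero_of_derivation δ hz hzF K N' le_rfl e'
  have := ext_smul_eq_zero_of_isSyzygy_of_forall d hK h1 N hN
  rw [add_comm] at this
  exact this e

end Jacobian

/-! ## The `z`-partial: `n zⁿ⁻¹` lies in the noether different -/

section NoetherHalf

variable {S : Type u} [CommRing S] {B : Type u} [CommRing B] [Algebra S B]

/-- **`n zⁿ⁻¹ ∈ 𝔑(B/S)` for `B = S[z]`, `zⁿ + F = 0`.** The element
`t = Σ_{i<n} zⁱ ⊗ zⁿ⁻¹⁻ⁱ ∈ B ⊗_S B` centralises the two `B`-structures — for `b = z` the difference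
`(z ⊗ 1 - 1 ⊗ z) t` telescopes to `zⁿ ⊗ 1 - 1 ⊗ zⁿ = (-F) ⊗ 1 - 1 ⊗ (-F) = 0`, and the set of
centralised `b` is an `S`-subalgebra — and multiplies to `μ(t) = n zⁿ⁻¹` (the classical "Euler"
element: the different of a monogenic algebra contains the derivative of the relation). [folklore] -/
theorem natCast_mul_pow_mem_noetherDifferent {z : B} (hz : Algebra.adjoin S {z} = ⊤) {n : ℕ}
    {F : S} (hzF : z ^ n + algebraMap S B F = 0) :
    (n : B) * z ^ (n - 1) ∈ noetherDifferent S B := by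
  have hzn : z ^ n = -algebraMap S B F := eq_neg_of_add_eq_zero_left hzF
  rw [mem_noetherDifferent_iff]
  refine ⟨∑ i ∈ Finset.range n, (z ^ i) ⊗ₜ[S] (z ^ (n - 1 - i)), ?_, ?_⟩
  · -- the centralising property, by induction over `B = S[z]`
    intro b
    have hb : b ∈ Algebra.adjoin S ({z} : Set B) := by rw [hz]; exact Algebra.mem_top
    refine Algebra.adjoin_induction (p := fun b _ =>
      (b ⊗ₜ[S] (1 : B)) * (∑ i ∈ Finset.range n, (z ^ i) ⊗ₜ[S] (z ^ (n - 1 - i))) =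
        ((1 : B) ⊗ₜ[S] b) * ∑ i ∈ Finset.range n, (z ^ i) ⊗ₜ[S] (z ^ (n - 1 - i))) ?_ ?_ ?_ ?_ hb
    · intro x hx
      rw [Set.mem_singleton_iff.mp hx, Finset.mul_sum, Finset.mul_sum, ← sub_eq_zero,
        ← Finset.sum_sub_distrib]
      have hterm : ∀ i ∈ Finset.range n,
          (z ⊗ₜ[S] (1 : B)) * ((z ^ i) ⊗ₜ[S] (z ^ (n - 1 - i))) -
            ((1 : B) ⊗ₜ[S] z) * ((z ^ i) ⊗ₜ[S] (z ^ (n - 1 - i))) =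
          (z ^ (i + 1)) ⊗ₜ[S] (z ^ (n - (i + 1))) - (z ^ i) ⊗ₜ[S] (z ^ (n - i)) := by
        intro i hi
        have hi' : i < n := Finset.mem_range.mp hi
        rw [Algebra.TensorProduct.tmul_mul_tmul, Algebra.TensorProduct.tmul_mul_tmul, one_mul,
          one_mul, ← pow_succ', ← pow_succ', show n - 1 - i + 1 = n - i by omega,
          show n - 1 - i = n - (i + 1) by omega]
      rw [Finset.sum_congr rfl hterm,
        Finset.sum_range_sub (fun i => (z ^ i) ⊗ₜ[S] (z ^ (n - i))), Nat.sub_self, pow_zero,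
        Nat.sub_zero, hzn, TensorProduct.neg_tmul, TensorProduct.tmul_neg,
        Algebra.algebraMap_eq_smul_one, TensorProduct.smul_tmul, sub_self]
    · intro s
      rw [Algebra.algebraMap_eq_smul_one, TensorProduct.smul_tmul]
    · intro x y _ _ hx hy
      rw [TensorProduct.add_tmul, TensorProduct.tmul_add, add_mul, add_mul, hx, hy]
    · intro x y _ _ hx hy
      have ex : (x * y) ⊗ₜ[S] (1 : B) = (x ⊗ₜ[S] (1 : B)) * (y ⊗ₜ[S] (1 : B)) := by
        rw [Algebra.TensorProduct.tmul_mul_tmul, mul_one]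
      have ey : (1 : B) ⊗ₜ[S] (x * y) = ((1 : B) ⊗ₜ[S] y) * ((1 : B) ⊗ₜ[S] x) := by
        rw [Algebra.TensorProduct.tmul_mul_tmul, mul_one, mul_comm y x]
      rw [ex, ey, mul_assoc, hy, ← mul_assoc, mul_comm (x ⊗ₜ[S] (1 : B)), mul_assoc, hx,
        ← mul_assoc]
  · rw [map_sum]
    have hterm : ∀ i ∈ Finset.range n,
        Algebra.TensorProduct.lmul' (S := B) S ((z ^ i) ⊗ₜ[S] (z ^ (n - 1 - i))) = z ^ (n - 1) := by
      intro i hi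
      have hi' : i < n := Finset.mem_range.mp hi
      rw [Algebra.TensorProduct.lmul'_apply_tmul, ← pow_add, show i + (n - 1 - i) = n - 1 by omega]
    rw [Finset.sum_congr rfl hterm, Finset.sum_const, Finset.card_range, nsmul_eq_mul]

/-- `Ext` out of `B|_S` vanishes in positive degrees when `B` is `S`-projective, so the ideal
`I' = ann_S Ext^{≥1}_S(B, mod S)` of [IyengarTakahashi2014, Prop. 3.4] is the unit ideal. [folklore] -/
theorem extAnnihilatorFrom_restrictScalars_eq_top [Module.Projective S B] :
    extAnnihilatorFrom ((restrictScalarsFunctor S B).obj (ModuleCat.of B B)) 1 = ⊤ := by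
  rw [eq_top_iff]
  intro a _
  rw [mem_extAnnihilatorFrom_iff]
  intro i hi N _ e
  haveI : Projective ((restrictScalarsFunctor S B).obj (ModuleCat.of B B)) :=
    projective_restrictScalars (ModuleCat.of B B)
  obtain ⟨j, rfl⟩ : ∃ j, i = j + 1 := ⟨i - 1, by omega⟩
  rw [Ext.eq_zero_of_projective e, smul_zero]

/-- **`n zⁿ⁻¹ ∈ caᵈ⁺¹(S[z]/(zⁿ + F))`** (the `z`-partial of the Jacobian criterion): with `S`
noetherian, `caᵈ⁺¹(S) = S`, `B = S[z]` finitely generated projective over `S` and `zⁿ + F = 0`,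
[IyengarTakahashi2014, Prop. 3.4] (`𝔑(B/S) · I'ᵈ ⊆ caᵈ⁺¹(B)`, here `I' = S`) applied to
`n zⁿ⁻¹ ∈ 𝔑(B/S)`. [folklore] -/
theorem natCast_mul_pow_mem_cohomologyAnnihilatorOfDegree [IsNoetherianRing S] [Module.Finite S B]
    [Module.Projective S B] {d : ℕ} (hvan : cohomologyAnnihilatorOfDegree S (d + 1) = ⊤) {z : B}
    (hz : Algebra.adjoin S {z} = ⊤) {n : ℕ} {F : S} (hzF : z ^ n + algebraMap S B F = 0) :
    (n : B) * z ^ (n - 1) ∈ cohomologyAnnihilatorOfDegree B (d + 1) := by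
  have h1 : (1 : S) ∈ extAnnihilatorFrom ((restrictScalarsFunctor S B).obj (ModuleCat.of B B)) 1 ^ d := by
    rw [extAnnihilatorFrom_restrictScalars_eq_top, Ideal.top_pow]
    exact Submodule.mem_top
  have h := noetherDifferent_mul_mem_cohomologyAnnihilatorOfDegree hvan
    (natCast_mul_pow_mem_noetherDifferent hz hzF) h1
  rwa [map_one, mul_one] at h

/-- **Hypersurface Jacobian criterion (monogenic form).** With `S` noetherian, `caᵈ⁺¹(S) = S`,
`B = S[z]` finitely generated projective over `S`, `zⁿ + F = 0`, and any family of derivations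
`δᵢ` of `S`: the ideal `(n zⁿ⁻¹, δᵢ F : i) B` lies in `caᵈ⁺¹(B)`. [folklore] -/
theorem span_jacobian_le_cohomologyAnnihilatorOfDegree [IsNoetherianRing S] [Module.Finite S B]
    [Module.Projective S B] {d : ℕ} (hvan : cohomologyAnnihilatorOfDegree S (d + 1) = ⊤)
    {R : Type*} [CommRing R] [Algebra R S] {ι : Type*} (δ : ι → Derivation R S S) {z : B}
    (hz : Algebra.adjoin S {z} = ⊤) {n : ℕ} {F : S} (hzF : z ^ n + algebraMap S B F = 0) :
    Ideal.span (insert ((n : B) * z ^ (n - 1)) (Set.range fun i => algebraMap S B (δ i F))) ≤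
      cohomologyAnnihilatorOfDegree B (d + 1) := by
  rw [Ideal.span_le]
  rintro x (rfl | ⟨i, rfl⟩)
  · exact natCast_mul_pow_mem_cohomologyAnnihilatorOfDegree hvan hz hzF
  · exact algebraMap_derivation_mem_cohomologyAnnihilatorOfDegree hvan (δ i) hz hzF

end NoetherHalf

/-! ## Corollaries: `S[X]/(Xⁿ + F)` and the polynomial base -/

section Corollaries

open Polynomial

variable {S : Type u} [CommRing S]

/-- `S[X]/(Xⁿ + F)` (`n ≠ 0`) is free of finite rank over `S` (power basis of the monic
`Xⁿ + F`). [folklore] -/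
theorem adjoinRoot_free_finite {n : ℕ} (hn : n ≠ 0) (F : S) :
    Module.Free S (AdjoinRoot (X ^ n + C F : S[X])) ∧
      Module.Finite S (AdjoinRoot (X ^ n + C F : S[X])) :=
  ⟨Module.Free.of_basis (AdjoinRoot.powerBasis' (monic_X_pow_add_C F hn)).basis,
    Module.Finite.of_basis (AdjoinRoot.powerBasis' (monic_X_pow_add_C F hn)).basis⟩

/-- **`δF ∈ caᵈ⁺¹(S[X]/(Xⁿ + F))`** for `S` noetherian with `caᵈ⁺¹(S) = S`, `n ≠ 0`, `δ` any
derivation of `S`. [folklore] -/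
theorem adjoinRoot_algebraMap_derivation_mem [IsNoetherianRing S] {d : ℕ}
    (hvan : cohomologyAnnihilatorOfDegree S (d + 1) = ⊤) {R : Type*} [CommRing R] [Algebra R S]
    (δ : Derivation R S S) {n : ℕ} (hn : n ≠ 0) (F : S) :
    algebraMap S (AdjoinRoot (X ^ n + C F : S[X])) (δ F) ∈
      cohomologyAnnihilatorOfDegree (AdjoinRoot (X ^ n + C F : S[X])) (d + 1) := by
  obtain ⟨hfree, hfin⟩ := adjoinRoot_free_finite hn F
  haveI := hfree
  haveI := hfin
  exact algebraMap_derivation_mem_cohomologyAnnihilatorOfDegree hvan δ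
    (AdjoinRoot.adjoinRoot_eq_top (f := X ^ n + C F)) (root_pow_add_algebraMap_eq_zero n F)

/-- **`n zⁿ⁻¹ ∈ caᵈ⁺¹(S[X]/(Xⁿ + F))`** (`z` the class of `X`) for `S` noetherian with
`caᵈ⁺¹(S) = S`, `n ≠ 0`. [folklore] -/
theorem adjoinRoot_natCast_mul_root_pow_mem [IsNoetherianRing S] {d : ℕ}
    (hvan : cohomologyAnnihilatorOfDegree S (d + 1) = ⊤) {n : ℕ} (hn : n ≠ 0) (F : S) :
    (n : AdjoinRoot (X ^ n + C F : S[X])) * AdjoinRoot.root (X ^ n + C F : S[X]) ^ (n - 1) ∈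
      cohomologyAnnihilatorOfDegree (AdjoinRoot (X ^ n + C F : S[X])) (d + 1) := by
  obtain ⟨hfree, hfin⟩ := adjoinRoot_free_finite hn F
  haveI := hfree
  haveI := hfin
  exact natCast_mul_pow_mem_cohomologyAnnihilatorOfDegree hvan
    (AdjoinRoot.adjoinRoot_eq_top (f := X ^ n + C F)) (root_pow_add_algebraMap_eq_zero n F)

/-- **Jacobian criterion for `zⁿ + F(x₁, …, x_d)` over a field** (every characteristic): in
`B = k[x₁, …, x_d][z]/(zⁿ + F)` (`n ≠ 0`) the Jacobian ideal `(n zⁿ⁻¹, ∂F/∂x₁, …, ∂F/∂x_d) B` lies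
in `caᵈ⁺¹(B)` — `caᵈ⁺¹(k[x₁, …, x_d]) = k[x₁, …, x_d]` by Hilbert's syzygy theorem
(`cohomologyAnnihilatorOfDegree_mvPolynomial_eq_top`). [folklore] -/
theorem mvPolynomial_span_jacobian_le (k : Type u) [Field k] (d : ℕ) {n : ℕ} (hn : n ≠ 0)
    (F : MvPolynomial (Fin d) k) :
    Ideal.span (insert
        ((n : AdjoinRoot (X ^ n + C F : (MvPolynomial (Fin d) k)[X])) *
          AdjoinRoot.root (X ^ n + C F : (MvPolynomial (Fin d) k)[X]) ^ (n - 1))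
        (Set.range fun i : Fin d =>
          algebraMap (MvPolynomial (Fin d) k) (AdjoinRoot (X ^ n + C F : (MvPolynomial (Fin d) k)[X]))
            (MvPolynomial.pderiv i F))) ≤
      cohomologyAnnihilatorOfDegree (AdjoinRoot (X ^ n + C F : (MvPolynomial (Fin d) k)[X]))
        (d + 1) := by
  obtain ⟨hfree, hfin⟩ := adjoinRoot_free_finite hn F
  haveI := hfree
  haveI := hfin
  exact span_jacobian_le_cohomologyAnnihilatorOfDegree
    (cohomologyAnnihilatorOfDegree_mvPolynomial_eq_top k d) (fun i => MvPolynomial.pderiv i)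
    (AdjoinRoot.adjoinRoot_eq_top (f := X ^ n + C F)) (root_pow_add_algebraMap_eq_zero n F)

end Corollaries

/-! ## The noether different of a projective finite extension -/

section NoetherProjective

variable {S : Type u} [CommRing S] {B : Type u} [CommRing B] [Algebra S B]

/-- **`𝔑(B/S) ⊆ caᵈ⁺¹(B)` for `B` module-finite and projective over a noetherian `S` with
`caᵈ⁺¹(S) = S`** — Iyengar–Takahashi's Prop. 3.4 (`𝔑(B/S) · I'ᵈ ⊆ caᵈ⁺¹(B)`, tree
`noetherDifferent_mul_mem_cohomologyAnnihilatorOfDegree`) with `I' = S`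
(`extAnnihilatorFrom_restrictScalars_eq_top`: `B|_S` is projective). No monogenicity needed; e.g.
every module-finite extension of a regular ring of dimension `≤ d` that is projective over it (every
Cohen–Macaulay one, by Auslander–Buchsbaum). [folklore] -/
theorem noetherDifferent_le_cohomologyAnnihilatorOfDegree [IsNoetherianRing S] [Module.Finite S B]
    [Module.Projective S B] {d : ℕ} (hvan : cohomologyAnnihilatorOfDegree S (d + 1) = ⊤) :
    noetherDifferent S B ≤ cohomologyAnnihilatorOfDegree B (d + 1) := by
  intro x hx
  have h1 : (1 : S) ∈
      extAnnihilatorFrom ((restrictScalarsFunctor S B).obj (ModuleCat.of B B)) 1 ^ d := by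
    rw [extAnnihilatorFrom_restrictScalars_eq_top, Ideal.top_pow]
    exact Submodule.mem_top
  have h := noetherDifferent_mul_mem_cohomologyAnnihilatorOfDegree hvan hx h1
  rwa [map_one, mul_one] at h

end NoetherProjective

end Summit.ResolutionOfSingularities.ResolutionOfSingularities.Theorems.HomologicalConductor.PersistenceHypersurfaceJacobian

end
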